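import Mathlib
import HarnessLib
import HarnessLib.Audit
import Summits.Langlands.Statement
import Literature.NumberTheory.Automorphic.TorsionHeckeEigensystem
import HarnessLib.Audit.Status.Attr

/-!
Route: KleinTorsionDoor

DORMANT since 2026-08-22T19:38:25Z (reconciler: no traction for 5.6 d (last activity item-evidence-added at 2026-08-17T04:28:02Z); parked, not closed — `ledger route dormant route-Langlands-KleinTorsionDoor --off` to reactivate) — unstaffed, not closed; items shared with open routes are served there. `ledger route dormant <id> --off` reactivates.

# Route KleinTorsionDoor — Klein-image rank-3 Artin reps are residually Sym² f mod 7 for free; the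
endgame is torsion occurrence in SL3(Z)-cohomology at every 7-adic depth plus Artin-weight
classicality on GL3/Q

X = KleinStrongArtin ("it suffices to show X", modulo the junction): every continuous σ : Γ_ℚ →
GL₃(ℂ) that is
irreducible, has image isomorphic to the simple group GL₃(𝔽₂) ≅ PSL₂(𝔽₇) of order 168 (the Klein
group — by Blichfeldt one
of the three simple primitive subgroups of PGL₃(ℂ)), and is of ODD type (complex conjugation acts
non-trivially: the Klein
field is not totally real) is automorphic in Tunnell's a.e. sense: an L-algebraic cuspidal π on
GL₃(𝔸_ℚ) whose Satake
parameters are the Frobenius eigenvalues of σ at almost all places (the tree's `IsPiOfArtinRep`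
idiom, unfolded). X is
reached as Door ∧ α ∧ β: the Door (support, theorem-sized) puts the mod-𝔪 Hecke eigensystem of ι⁻¹σ
into
H^•(Γ₁(N) ⊂ SL₃(ℤ), 𝔽̄₇) for free (Tate lift + Khare–Wintenberger at p = 7 + the 7-modular Brauer
table of PSL₂(7) +
Gelbart–Jacquet + Ash–Stevens); crux α (SeptadicTorsionOccurrence) lifts occurrence from 𝔪 to every
depth 7^s in the
Hecke-algebra (Spf 𝕋) sense — the faithful form of the card's "big R = T_𝔪 ⇒ σ ∈ Spf T_𝔪"; crux β
(ArtinTorsionClassicalityGL3) turns occurrence at all depths into automorphy at weight (0,0,0).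
Realises idea card
psl2q-artin-door-rank3 (spine). The sector statement X → Langlands is the support item
KleinArtinJunction (the rest of the
summit), so the deciding theorem `closes : Door → α → β → Junction → Langlands` is pure logic (ι :
ℚ̄₇ ≃+* ℂ built inline).
Lean: `∀ σ : Literature.NumberTheory.GaloisRepresentations.FramedGaloisRep ℚ ℂ 3,
σ.toGaloisRep.IsIrreducible → Nonempty (↥σ.toMonoidHom.range ≃* GL (Fin 3) (ZMod 2)) → (∀ (φ : ℚ →+*
ℝ) (c : Field.absoluteGaloisGroup ℚ),
Literature.NumberTheory.GaloisRepresentations.IsComplexConjugation φ c → σ c ≠ 1) → ∃ (hcpt :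
Literature.NumberTheory.Automorphic.isCompact_glFiniteIntegralLevel 3 ℚ) (π :
Literature.NumberTheory.Automorphic.CuspidalAutomorphicRepData 3 ℚ hcpt), π.1.IsLAlgebraic ∧ ∀ᶠ v :
IsDedekindDomain.HeightOneSpectrum (NumberField.RingOfIntegers ℚ) in Filter.cofinite, ∃ α : Multiset
ℂ, π.1.HasSatakeParamAt v α ∧ σ.IsUnramifiedAt v ∧ σ.HasFrobCharpolyAt v
(Literature.NumberTheory.Automorphic.satakePolynomial α)`

## Assembly
DECIDING THEOREM (D-0027 §2.1; glue.lean, proved sorry-free in Sketch.lean together with all items,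
`lean check` rc 0,
axioms standard): `theorem closes : ResidualSymSquareTorsionDoor → SeptadicTorsionOccurrence →
ArtinTorsionClassicalityGL3 →
KleinArtinJunction → Langlands`. Proof (pure logic): `Fact (Nat.Prime 7)` by `norm_num`; an abstract
field isomorphism
ι : ℚ̄₇ ≃+* ℂ exists (both algebraically closed of characteristic 0 and cardinality 𝔠 — proved
inline from Mathlib,
`IsAlgClosed.ringEquiv_of_equiv_of_charZero`, exactly as in the sibling EvenArtinGL4Door);
KleinArtinJunction reduces the
summit to X; given an irreducible odd Klein σ, the Door yields mod-𝔪 occurrence, α upgrades it to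
occurrence at every depth
7^s, β (fed `Finite ↥σ.range`, from the isomorphism with the finite group GL₃(𝔽₂),
`Finite.of_equiv`) returns the cuspidal
π. The item `Assembly` (the same implication as a Prop) is bookkeeping, proved by the same term
(`assembly_holds`).

Rationale: WHY THIS LINE. Mechanism of card psl2q-artin-door-rank3, re-typed after the g1 route
(route-Langlands-PSL2ArtinDoor) was retired
not-a-thesis. (1) THE DOOR IS FREE: PSL₂(𝔽₇) is its own residual avatar — Tate-lift Γ_ℚ → PSL₂(𝔽₇) ⊂
PGL₂(𝔽̄₇) to σ̃ (a
genuine involution at c, non-scalar because σ(c) ≠ 1 in the centreless image, hence det σ̃(c) = −1: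
ODD), so
σ̃ ≅ ρ̄_g for a newform g of weight ≥ 2 (KhareWintenberger2009); both degree-3 characters of PSL₂(7)
reduce modulo the
unique prime 𝔭 = (√−7) over 7 to the Brauer character of L(2) = Ad⁰ (Humphreys2005), so σ̄ ≅
Ad⁰(ρ̄_g) is the reduction of
the REGULAR algebraic cuspidal Gelbart–Jacquet lift Ad(π_g) (GelbartJacquet1978; g is non-CM since
its projective image is
PSL₂(7)), whose eigensystem lies in Betti cohomology of SL₃(ℤ)-congruence subgroups and descends to
trivial weight at level
7 | N (Ash–Stevens doi:10.1515/crll.1986.365.192). (2) THE g2 CORRECTION — TORSION, NOT CLASSICAL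
LIMITS: σ is not
essentially self-dual (its character takes the non-real value b7 = (−1+√−7)/2), and since (7) = 𝔭²
and b7 − b̄7 = √−7 has
𝔭-valuation 1, σ is 7-adically separated from the whole essentially-self-dual locus (all Sym² lifts
and their twists)
already modulo 7: on GL₃/ℚ (defect l₀ = 1) the Ash–Pollack–Stevens / Calegari–Mazur rigidity
heuristics
(doi:10.1112/plms/pdm048, arXiv:0708.2451) then say regular classical points should NOT accumulate
at x_σ, so the sibling
route's characteristic-0 idiom ("p-adic limit of regular algebraic cuspidal Π_s", EvenArtinGL4Door,
which escapes to a
GSp₄ family) is unavailable here and every self-dualisation trick fails to return to σ (σ ⊕ σ^∨ on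
SO₇ is Eisenstein, Sym²σ
and ad⁰σ have no descent, the Klein-quartic CM twist stays non-polarisable). Hence α is typed in its
honest form —
occurrence of σ mod 7^s in H^i(Γ₁(N) ⊂ SL₃(ℤ), 𝒪/7^s) as a point of the Hecke algebra (Scholze2015
§V.4 /
CalegariEmerton2011 §8 sense; tree vocabulary TorsionHeckeEigensystem / SLn.heckeT / SLn.diamondOp,
definition-only, cone
clean), i.e. Hansen's occurrence conjecture arXiv:1412.1533 Conj. 1.2.3 / big R = T_𝔪
(CalegariGeraghty2017,
arXiv:1609.06965) read at finite level — and β is the archimedean realisation at weight −ρ with NO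
classical points
nearby, the sharpest form of the Artin-sector wall. (3) THE FORCED PRIME IS A BAD TAYLOR–WILES
PRIME:
ad⁰L(2) = L(4) ⊕ L(2) and H¹(SL₂(𝔽₇), L(4)) ≠ 0 (Cline–Parshall–Scott), so the H¹-clause of adequacy
fails for every
Klein σ at its only usable prime (Thorne2012, doi:10.1007/s13373-011-0018-z); α's intended proof
needs H¹-tolerant
patching (auxiliary Steinberg prime à la Thorne), named, not hidden. Imported areas: modular
representation theory of
finite groups of Lie type (Brauer tables, CPS cohomology), torsion cohomology of arithmetic groups /
completed cohomology
(Ash, Scholze, Calegari–Emerton–Geraghty, Gee–Newton), p-adic rigidity (APS, Calegari–Mazur). No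
analytic, probabilistic
or physical reformulation: none offers a residual foothold for an insoluble non-self-dual image.
What it does that the
retired g1 route did not: the assembly now decides `_root_.Langlands` (junction), no unproved named
fact sits in the cone
(KW moved inside the Door's proof plan), and α/β are stated in the torsion form the mechanism
actually requires.

RANKED CRUXES. #0 KleinStrongArtin (target) — strong Artin in Tunnell's a.e. sense for every
irreducible σ : Γ_ℚ → GL₃(ℂ) with image ≅ GL₃(𝔽₂) ≅ PSL₂(𝔽₇) on which complex conjugation is
non-trivial: ∃ L-algebraic cuspidal π on GL₃(𝔸_ℚ) with Satake parameter = Frobenius eigenvalues at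
almost all v. The odd-type Klein member of the insoluble rank-3 sector of conjunct (B) at n = 3, F =
ℚ, Hodge–Tate weights (0,0,0); general projective-Klein σ = ψ ⊗ σ₀ reduce to it by a twist (not
decomposed). (why it might fail: False only if Langlands (B) fails for an odd Klein σ/ℚ. No engine:
insoluble non-self-dual image (no base-change tower, no unitary/GSp descent), no Shimura host for
GL₃/ℚ, holomorphy of twisted Artin L-functions unknown (no converse theorem); Calegari 2109.14145
§12.) [Calegari2023, BuzzardGeeLMS2014, KhareWintenberger2009, arXiv:math/0102233]
#2 SeptadicTorsionOccurrence (crux) — (card crux α, in torsion form) Let σ be of odd Klein type and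
ι : ℚ̄₇ ≃ ℂ. If the mod-𝔪 eigensystem of ι⁻¹σ occurs in some H^i(Γ₁(N) ⊂ SL₃(ℤ), 𝔽̄₇), N > 0 (an
𝔽̄₇-eigenvector of all T(ℓ,k), ℓ ∤ N prime, k ≤ 3, and of the diamond operators, whose
Hecke–Frobenius polynomial X³ − a(ℓ,1)X² + ℓ a(ℓ,2)X − ℓ³ ε(ℓ) is ≡ charpoly ι⁻¹σ(Frob_ℓ) mod 𝔪 at
every ℓ ∤ N, and σ unramified at every such ℓ), then for EVERY s ≥ 1 there are N_s > 0, i_s and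
lifts a, ε to 𝒪 = 𝒪_{ℚ̄₇} such that T(ℓ,k) ↦ a(ℓ,k), ⟨d⟩ ↦ ε(d) mod 7^s kills every
(non-commutative) polynomial relation among these operators on H^{i_s}(Γ₁(N_s), 𝒪/7^s) — i.e.
extends to an algebra homomorphism from the Hecke algebra they generate to 𝒪/7^s — with the same
Frobenius congruences mod 7^s. Informal content: σ is a point of Spf 𝕋(K^p)_𝔪 for the completed
cohomology of GL₃/ℚ at 𝔪 = 𝔪(Ad⁰ρ̄_g): the conclusion of big R_σ̄ = 𝕋_𝔪 (defect l₀ = 1) applied to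
the 𝒪-point σ of R_σ̄, read at finite level. Already s = 1 (mod 7 = 𝔭²) asks for a NON-self-dual
𝔽₇[ε]-eigensystem: the tangent direction of σ at 𝔪. [difficulty: open-problem] (why it might fail:
Needs big R=T_𝔪 for completed cohomology of GL₃/ℚ (l₀=1): only conditional (Gee–Newton), and all
patching needs H¹(im σ̄, ad⁰)=0, false here (Ext¹_{SL₂(7)}(L(0),L(4))≠0); even s=1 demands a
non-self-dual 𝔽₇[ε]-eigensystem (σ's tangent at 𝔪) that no lift and no computation has exhibited.)
[CalegariGeraghty2017, arXiv:1609.06965, arXiv:1412.1533, Scholze2015, Thorne2012,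
doi:10.1007/s13373-011-0018-z, Humphreys2005, doi:10.1112/plms/pdm048, arXiv:0708.2451,
AshGunnellsMcconnell2011, CalegariEmerton2011]
#3 ArtinTorsionClassicalityGL3 (crux) — (card crux β: archimedean realisation at weight (0,0,0) =
−ρ, torsion form) Let σ : Γ_ℚ → GL₃(ℂ) be irreducible with finite image and of odd type (σ(c) ≠ 1),
ι : ℚ̄₇ ≃ ℂ. If for every s ≥ 1 the eigensystem of ι⁻¹σ mod 7^s is a point of the Hecke algebra of
some H^i(Γ₁(N) ⊂ SL₃(ℤ), 𝒪/7^s), N > 0 (exactly the conclusion of SeptadicTorsionOccurrence), then σ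
is automorphic: ∃ L-algebraic cuspidal π on GL₃(𝔸_ℚ) with Satake parameter = Frobenius eigenvalues
of σ at almost all v. A special case of Fontaine–Mazur–Langlands for n = 3 over ℚ with the extra
hypothesis '7-adically pro-automorphic in torsion'; the expected π_∞ is the tempered principal
series of signs (1, sgn, sgn) at infinitesimal character 0. Stated for all odd finite-image σ
(shared by the Valentiner 3.A₆ and every other rank-3 Artin member), used by `closes` only for Klein
σ. [deps: SeptadicTorsionOccurrence] [difficulty: open-problem] (why it might fail: Weight
(0,0,0)=−ρ is no algebraic weight: σ's eigenspace in completed cohomology is non-locally-algebraic,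
GL₃/ℚ has no Shimura/coherent receptacle, classical points do not accumulate at x_σ
(APS/Calegari–Mazur rigidity): no overconvergent-to-classical argument; true under FM–Langlands.)
[FontaineMazurGeometric1995, BuzzardGeeLMS2014, Calegari2023, arXiv:1412.1533,
doi:10.1112/plms/pdm048, arXiv:0708.2451, CalegariEmerton2011, Scholze2015]
#9 ResidualSymSquareTorsionDoor (support) — (card item γ, the residual engine; theorem-sized modulo
theorems in print) for every ι : ℚ̄₇ ≃ ℂ and every σ : Γ_ℚ → GL₃(ℂ) with image ≅ GL₃(𝔽₂) and σ(c) ≠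
1, the mod-𝔪 eigensystem of ι⁻¹σ OCCURS (Ash's eigenvector sense, tree
`TorsionHeckeEigensystem.Occurs` over the residue field 𝔽̄₇ of 𝒪_{ℚ̄₇}) in some H^i(Γ₁(N) ⊂ SL₃(ℤ),
𝔽̄₇), N > 0, with Hecke–Frobenius polynomial X³ − a(ℓ,1)X² + ℓ a(ℓ,2)X − ℓ³ ε(ℓ) ≡ charpoly
ι⁻¹σ(Frob_ℓ) mod 𝔪 at every ℓ ∤ N (and σ unramified at every such ℓ). Proof plan: θ : im σ ≅ GL₃(𝔽₂)
≅ PSL₂(𝔽₇) ⊂ PGL₂(𝔽̄₇); Tate-lift θ∘σ to σ̃ : Γ_ℚ → GL₂(𝔽̄₇) unramified where σ is (SerreDurham1977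
§6); σ̃(c) is a non-scalar involution ⇒ det σ̃(c) = −1, σ̃ irreducible (projective image PSL₂(7)) ⇒
σ̃ ≅ ρ̄_g, g newform of weight k ≥ 2, level N(σ̃) (KhareWintenberger2009); 7-modular Brauer table of
PSL₂(7): the degree-3 characters (3,−1,0,1 on 1A,2A,3A,4A) are the Brauer character of L(2) = Ad⁰ of
the natural SL₂(𝔽₇)-module (Humphreys2005; GAP-certifiable) ⇒ (ι⁻¹σ)‾ ≅ Ad⁰(ρ̄_g) (Brauer–Nesbitt;
L(2) irreducible so no semisimplification issue); Ad(π_g) is cuspidal (g non-CM) regular algebraic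
on GL₃(𝔸_ℚ) with Galois representation Ad⁰ρ_g of Hodge–Tate weights {1−k, 0, k−1}
(GelbartJacquet1978), hence cohomological for the coefficient system of highest weight (k−3, −1,
1−k) at level K₁(N′) (JPSS newvectors); its eigensystem reduces into H^•(Γ₁(N′), V_λ ⊗ 𝔽̄₇)
(Ash–Stevens lemma) and then into trivial weight at level Γ₁(N′·7) up to a power of the mod-7
cyclotomic character (doi:10.1515/crll.1986.365.192 §3), which is undone by an ω-twist inside the
level-7^∞ tower (det σ = 1 forces ε(ℓ) ≡ ℓ⁻³, so 7 | N); the SL₃(ℤ)- versus GL₃-quotient bookkeeping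
is a Hecke-stable ± summand (7 odd). Sanity of the normalisation: the trivial class has polynomial
(X−1)(X−ℓ)(X−ℓ²) = 1 ⊕ χ ⊕ χ² at arithmetic Frobenius. [difficulty: L] (why it might fail:
Bookkeeping risks only: Hecke–Frobenius normalisation (arithmetic Frob; X³−a₁X²+ℓa₂X−ℓ³ε(ℓ),
T(ℓ,3)=id), the ω-twist reaching det=1 at 7|N, Ash–Stevens reduction to trivial weight,
eigenvector-sense occurrence over 𝔽̄₇; KW(7), Tate lift, Brauer table, GJ: in print, not in Lean.)
[KhareWintenberger2009, SerreDurham1977, Humphreys2005, GelbartJacquet1978,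
doi:10.1515/crll.1986.365.192, AshGunnellsMcconnell2011, Scholze2015, arXiv:math/0102233]
#9 KleinArtinJunction (support) — X → Langlands: the rest of the summit (all other n, F, weights and
images; direction (A); the Valentiner/A₅ and totally-real Klein members; the upgrade of the a.e.
Satake–Frobenius matching to `Corresponds` at every finite place by local–global compatibility +
strong multiplicity one, incl. the π ↦ π^∨ bookkeeping between `satakePolynomial` and
`arithFrobPolyOfSatake ι q 1`). Not this route's business; filed so that `closes` ends in the summit
constant; shared junction for every rank-3 Artin card over ℚ. [difficulty: open-problem]
[BuzzardGeeLMS2014, FontaineMazurGeometric1995, Calegari2023]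

TWO-LAYER PLAN. Foreseen glued splits (k ≤ 3, depth 1), filed only when a crux moves.
SeptadicTorsionOccurrence ⇐ TangentAtSeven (s = 1:
the 𝔽₇[ε]-point of the Hecke algebra at 𝔪 in σ's non-self-dual direction exists — computable, see
Cheapest falsifier) →
BigRTKleinSeven (R_{σ̄,S} → 𝕋(K^p)_𝔪 is an isomorphism for the GL₃/ℚ completed-cohomology Hecke
algebra with its
determinant, typed over the tree's CompletedCohomologyGL / ScholzeTorsionGalois vocabulary; the
H¹-tolerant patching with
an auxiliary Steinberg prime q ≡ 1 mod 7, σ̄(Frob_q) of order 7, lives here) → FiniteLevelReadout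
(Spf-point ⇒ finite-level
Hecke-algebra occurrence with the Frobenius congruences: elementary, the converse bookkeeping of the
tree's
CompletedCohomologyPoints) → α. ArtinTorsionClassicalityGL3 ⇐ EigenvarietyMembership (occurrence at
all depths ⇒ x_σ is a
point of the tame-level-N GL₃/ℚ eigenvariety; σ is ordinary for every refinement at ℓ = 7 ∤ cond,
finite slope in
general) → ArtinPointIsClassical (a de Rham point of Hodge–Tate type (0,0,0) on a genuine GL₃
eigenvariety component is
cuspidal automorphic with π_∞ of Artin type) → β. A parallel Valentiner route (3.A₆ at p = 3 = n,
outside every adequacy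
and Fontaine–Laffaille range) would share β verbatim and file its own door and α.

KILL CRITERIA. (i) A refutation of ResidualSymSquareTorsionDoor as typed (normalisation / twist /
eigenvector-sense slip) is a MISSTATED
repair (add the repaired door, re-certify closes), unless the Brauer identity or the parity step
itself fails for some
Klein field — then close `refuted:ResidualSymSquareTorsionDoor` (the card dies: no free residual
input). (ii) The
decisive kill of the LINE: a theorem, or an exhaustive computation at all accessible levels 3^a·7^r
for the Trinks field,
showing that the 𝔽₇[ε]-tangent direction of σ is absent from the 𝔪_σ̄-part of H^•(Γ₁(N), 𝔽₇) — i.e.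
α fails at s = 1 —
closes the route `refuted:SeptadicTorsionOccurrence` and records that the completed-cohomology
endgame cannot see
non-self-dual Artin points of GL₃/ℚ (informative for every Artin card). (iii) A theorem that big R =
𝕋_𝔪 FAILS in
positive defect when H¹(im ρ̄, ad⁰) ≠ 0 (not merely that proofs need adequacy) sends the route
dormant pending the
tangent computation. (iv) β can only be refuted together with Langlands (B) for n = 3 — a summit
event. (v) X proved
elsewhere (Artin holomorphy + a GL₃ converse theorem, or a new descent) moots the route; α and β
remain GL₃ p-adic
statements of independent interest.

NOT DECOMPOSED YET. By design (D-0019): the split of α into tangent / big R = T / finite-level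
readout and the choice of auxiliary
Taylor–Wiles–Thorne primes; the definition-level instance "𝕋(K^p)_𝔪 of GL₃/ℚ with its 3-dimensional
determinant" (the
tree's CompletedCohomologyGL, CompletedCohomologyHeckeAlgebraGLn, ScholzeTorsionGalois modules
exist; no new definition is
needed at layer 1); the twist reduction of general projective-Klein σ = ψ ⊗ σ₀ and the transfer of
automorphy along ψ
(routine, support later); the Valentiner (3.A₆, p = 3) and A₅ (= Ad of icosahedral, known iff odd)
members of
Blichfeldt's list; the (p−1)-dimensional cuspidal family of the card (GL₆ for PSL₂(7)); the totally
real (even) Klein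
fields (sealed: every lift σ̃ is even, no KW); the all-places upgrade and π ↦ π^∨ conventions
(junction); the relation
between eigenvector-sense and Hecke-algebra-sense occurrence beyond what `closes` needs (Door is
stated in Ash's
eigenvector sense over the field 𝔽̄₇, where the two agree; depths s ≥ 1 in the Spf-point sense,
which is what R = T
delivers).

CHEAPEST FALSIFIER. (a) Ten minutes of GAP: the 7-modular decomposition matrix of PSL₂(7) — both
ordinary degree-3 characters must restrict on
7-regular classes (1A,2A,3A,4A: 3,−1,0,1) to the Brauer character of the 3-dimensional simple module
L(2) = Ad⁰; anything
else kills the Door. (Known tables say yes; not re-run here: hub compute-free.) (b) The decisive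
cheap probe of α at s = 1:
Trinks' field x⁷ − 7x + 3 (group PSL₂(7), ramified only at 3 and 7, three real roots ⇒ c ≠ 1, odd
type), so in
characteristic 7 the tame level is a small power of 3: compute the 𝔪_σ̄-part of H³ and H² of
Γ₁(3^a·7^r) ⊂ SL₃(ℤ) with 𝔽₇-
and 𝔽₇[ε]-coefficients by Voronoi/sharbly methods (doi:10.1016/0022-314x(84)90081-7,
arXiv:1002.3385, arXiv:2410.02734) and
test (1) σ̄ = Ad⁰ρ̄_g is present (it must be: Door) and (2) the Hecke algebra at 𝔪 has the
𝔽₇[ε]-point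
t(ℓ) = (tr σ(Frob_ℓ) − tr σ(Frob_ℓ⁻¹))/√−7 mod 𝔭 prescribed by σ (non-zero exactly at the order-7
Frobenius classes).
Absence of (2) at every computable level is evidence against α; presence would be the first
non-self-dual torsion shadow of an
insoluble Artin representation. Not run (compute-free hub; a ≤ 3, r ≤ 2 is at the edge of published
SL₃ ranges).

NUMBERS. |PSL₂(7)| = 168 = 2³·3·7; Blichfeldt's simple primitive subgroups of PGL₃(ℂ): A₅, PSL₂(7),
A₆ (as 3.A₆). Degree-3
characters of PSL₂(7): (3, −1, 0, 1, b7, b̄7) on (1A, 2A, 3A, 4A, 7A, 7B), b7 = (−1+√−7)/2, field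
ℚ(√−7), (7) = 𝔭²,
v_𝔭(b7 − b̄7) = v_𝔭(√−7) = 1 < 2 = v_𝔭(7) ⇒ σ ≢ r mod 7 for every essentially self-dual r (so depth
s = 1 is already
off the Sym² locus). 7-modular simples of SL₂(7) in the principal block: L(0), L(2), L(4), L(6) of
dimensions 1, 3, 5, 7;
L(2) ⊗ L(2) = L(4) ⊕ L(2) ⊕ L(0); H¹(SL₂(𝔽₇), L(4)) = 𝔽₇ ≠ 0 (Cline–Parshall–Scott: H¹(SL₂(p),
L(p−3)) ≠ 0), all other
H¹(L(n)), n ≤ 6, vanish ⇒ adequacy's H¹-clause fails, H⁰(ad⁰) = 0 and irreducibility hold. σ(c) ∼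
diag(1,−1,−1),
tr σ(c) = −1 (odd in the Caraiani–Le Hung sense |tr c| ≤ 1, arXiv:1409.2158). Deformations: 1 + h¹ −
h² =
1 + h⁰ + n² − dim(ad)^c = 1 + 1 + 9 − 5 = 6 = 1 + dim B(GL₃) − l₀ = 1 + 6 − 1 (Calegari–Emerton
dimension of 𝕋_𝔪);
l₀(GL₃/ℚ) = 1, q₀ = 2, cuspidal range [2,3] of the 5-dimensional locally symmetric space.
Hecke–Frobenius polynomial at
level Γ₁(N), trivial coefficients: X³ − a(ℓ,1)X² + ℓ a(ℓ,2) X − ℓ³ ε(ℓ) (arithmetic Frobenius;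
trivial class ↦
(X−1)(X−ℓ)(X−ℓ²)); det σ = 1 forces ε(ℓ) ≡ ℓ⁻³ mod 7^s, i.e. 7^s | N. Calibration field for (b): x⁷
− 7x + 3 (Trinks),
ramification {3, 7}; ADP's PSL₂(7) example x⁷ − 11x⁵ − 22x⁴ + 33x² + 33x + 11 (disc 11⁶·31²,
arXiv:math/0102233 §7.2) has
prime-to-7 conductor 11³·31² ≈ 1.3·10⁶ — unusable at p = 7, which is why Trinks' field is the probe.
Items at open: 6
(1 target, 2 cruxes, 2 support, 1 assembly).

DEFINITION REQUESTS. None at layer 1: `Literature.NumberTheory.Automorphic.TorsionHeckeEigensystem`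
(Γ₁(N) ⊂ SL_n(ℤ), H^i(Γ₁(N), A), T(ℓ,k),
⟨d⟩, `Occurs`) and ArithmeticQuotientCohomology are definition-only files and carry everything the
items state. For the
layer-2 split of α the GL₃/ℚ instance of the completed-cohomology Hecke algebra with determinant
will be assembled from the
existing CompletedCohomologyGL / CompletedCohomologyHeckeAlgebraGLn / ScholzeTorsionGalois modules
(definition item to be
filed with the split, not now). Cite facts the Door's PROOF will want as Literature theorems (to be
filed by whoever takes
it, `ledger workitem add --kind cite`): Tate lifting of projective representations with controlled
ramification
(SerreDurham1977 §6); the 7-modular decomposition matrix of PSL₂(7) (GAP-certifiable compute fact);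
Ash–Stevens
weight/level reduction of mod-p eigensystems to trivial weight at level Γ₁(Np)
(doi:10.1515/crll.1986.365.192 §3);
cohomological realisation of the Gelbart–Jacquet lift Ad(π_g) with its Hecke eigenvalues
(GelbartJacquet1978 +
Borel/Franke). KW at p = 7 is already the tree's named fact
`Literature.NumberTheory.Automorphic.khare_wintenberger` — it is
deliberately NOT referenced by any item (cone hygiene: it would make the route unstaffable); it is a
hypothesis of the
Door's future proof only.

Novelty: Searches (2026-08-15; local searchd DOWN all session — `lit search` rc 75 ×2 —, OpenAlex 429 daily
budget, Semantic Scholar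
429, arXiv API 0 rows; recorded for the refuter; the zbMATH cascade and galaxy worked): `lit search
--source zbmath`:
"torsion cohomology SL(3,Z) Galois representations" (4: arXiv:1002.3385 AGM, arXiv:1004.1083
Bergeron–Venkatesh, …),
"cuspidal cohomology SL(3,Z) computations" (2: doi:10.1016/0022-314x(84)90081-7 Ash–Grayson–Green,
arXiv:2410.02734 Porat
2025), "Galois representations Hecke eigenclasses reducible mod p GL(3) Serre conjecture" (1: Doud
2002 zbl:1035.11024),
"Galois representations with conjectural connections to arithmetic cohomology" (3:
arXiv:math/0102233 ADP — §7.2 READ from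
the materialised text: their PSL₂(7) example is x⁷−11x⁵−22x⁴+33x²+33x+11 in characteristic 11 ∤ 168,
level 31, i.e. the
OPPOSITE regime (ℓ ∤ |G|, no congruence door) —, Doud, arXiv:1206.6730), "rigidity p-adic cohomology
classes congruence
subgroups GL(n,Z)" (1: doi:10.1112/plms/pdm048 APS), "PSL(2,7) Galois representations" (3: none
automorphic;
doi:10.5802/jtnb.801 septimic fields), "patching and the completed homology of locally symmetric
spaces" (1:
arXiv:1609.06965), "automorphy lifting residually reducible" (2: Thorne JAMS 2015, ANT
arXiv:1912.11269), "automorphy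
small residual image" (3: arXiv:1107.5993 Thorne, arXiv:1112.4561 = doi:10.1007/s13373-011-0018-z
Guralnick adequate II);
zero rows for "Klein quartic Galois representation PSL(2,7) automorphic", "si  [refs: 10.1016/0022-314x(84, 10.1112/plms/pdm048, 10.5802/jtnb.801, 10.1007/s13373-011-0018-z, 10.1007/s00222-009-0205-7, 1002.3385, 1004.1083, 2410.02734, math/0102233, 1206.6730, 1609.06965, 1912.11269, 1107.5993, 1112.4561, 1412.1533, 0708.2451, doi:10.1016/0022-314x, doi:10.1112/plms/pdm048, doi:10.5802/jtnb.801, doi:10.1007/s13373-011-0018-z, doi:10.1007/s00222-009-0205-7]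

Barriers (technique_class: completed-cohomology congruences automorphy-lifting): - technique_class: completed-cohomology congruences automorphy-lifting
- Literature.Barriers.Langlands.NonRegularWeightBarrier: NOT evaded for ArtinTorsionClassicalityGL3
— that crux IS the barrier's residue (weight −ρ, no Betti/coherent realisation, and here not even
accumulating classical points), stated honestly as one archimedean statement over ℚ; evaded for the
Door and for SeptadicTorsionOccurrence, whose automorphic input lives in REGULAR weight (Ad(π_g), HT
{1−k,0,k−1}) and whose receptacle (torsion classes / completed cohomology) is insensitive to
Hodge–Tate multiplicity.
- Literature.Barriers.Langlands.TaylorWilesNumericalCoincidence: met head-on (n = 3, l₀(GL₃/ℚ) = 1):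
no single-degree Taylor–Wiles–Kisin patching; the bet inside α is Calegari–Geraghty / Gee–Newton
patching of completed homology in degrees [2,3] (CalegariGeraghty2017, arXiv:1609.06965) — inside
the technique class, flagged, plus the extra H¹-defect at the bad prime.
- Literature.Barriers.Langlands.TaylorWilesNumericalCoincidenceNarrow: σ is not polarisable (3 ≄ 3̄
⊗ χ: √−7 in the character; see Numbers), so the narrow barrier's unitary/GSp escape is unavailable
by construction; positive defect and torsion are accepted, not evaded.
- Literature.Barriers.Langlands.ResiduallyReducibleBarrier: σ̄ = L(2) = Ad⁰(ρ̄_g) is absolutely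
irreducible with H⁰(ad⁰) = 0, so the irreducibility conjuncts hold; but the H¹-clause of adequacy
FAILS at p = 7 (H¹(SL₂(𝔽₇), L(4)) ≠ 0) — declared as α's content with the Thorn

History (route lifecycle, newest last):
- 2026-08-22T19:38:25Z · DORMANT — reconciler: no traction for 5.6 d (last activity item-evidence-added at 2026-08-17T04:28:02Z); parked, not closed — `ledger route dormant route-Langlands-KleinT (operator:999:3980326)

sub-problem: Langlands · status: dormant · opened planner-plancard-Langlands-Langlands-psl2q-ar-094b763e-g2-0 2026-08-15T19:06:28Z · rev 3 · ledger route-Langlands-KleinTorsionDoor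
GENERATED by the gate from the ledger (D-0016/17). Provers cite these decls: `theorem foo : Summit.Langlands.Langlands.Theses.KleinTorsionDoor.<Decl> := …` in Summits/Langlands/Langlands/Theorems/<Name>.lean.
-/

namespace Summit.Langlands.Langlands.Theses.KleinTorsionDoor

open scoped BigOperators Topology Manifold Classical MeasureTheory ProbabilityTheory Matrix InnerProductSpace ComplexConjugate ContinuousMap
open Filter Set Function TopologicalSpace MeasureTheory

attribute [summit_statement] _root_.Langlands

/-- item stmt-Langlands-14192 · target · rank 0 · open · by planner
why it might fail: False only if Langlands (B) fails at n=3 for an odd Klein σ/ℚ. No engine: insoluble non-self-dual image GL₃(𝔽₂)≅PSL₂(7) (no solvable base change, no unitary/GSp descent), π_∞ non-cohomological, no Shimura host (Calegari2023 §12 'fourth class'), holomorphy of L(s,σ⊗τ) unknown (no converse theorem).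
sources: Calegari2023, BuzzardGeeLMS2014, KhareWintenberger2009, arXiv:math/0102233
[target] strong Artin in Tunnell's a.e. sense for every irreducible σ : Γ_ℚ → GL₃(ℂ) with image ≅
GL₃(𝔽₂) ≅ PSL₂(𝔽₇) on which complex conjugation is non-trivial: ∃ L-algebraic cuspidal π on GL₃(𝔸_ℚ)
with Satake parameter = Frobenius eigenvalues at almost all v. The odd-type Klein member of the
insoluble rank-3 sector of conjunct (B) at n = 3, F = ℚ, Hodge–Tate weights (0,0,0); general
projective-Klein σ = ψ ⊗ σ₀ reduce to it by a twist (not decomposed). -/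
@[route_item "route-Langlands-KleinTorsionDoor"]
def KleinStrongArtin : Prop :=
  ∀ σ : Literature.NumberTheory.GaloisRepresentations.FramedGaloisRep ℚ ℂ 3, σ.toGaloisRep.IsIrreducible → Nonempty (↥σ.toMonoidHom.range ≃* GL (Fin 3) (ZMod 2)) → (∀ (φ : ℚ →+* ℝ) (c : Field.absoluteGaloisGroup ℚ), Literature.NumberTheory.GaloisRepresentations.IsComplexConjugation φ c → σ c ≠ 1) → ∃ (hcpt : Literature.NumberTheory.Automorphic.isCompact_glFiniteIntegralLevel 3 ℚ) (π : Literature.NumberTheory.Automorphic.CuspidalAutomorphicRepData 3 ℚ hcpt), π.1.IsLAlgebraic ∧ ∀ᶠ v : IsDedekindDomain.HeightOneSpectrum (NumberField.RingOfIntegers ℚ) in Filter.cofinite, ∃ α : Multiset ℂ, π.1.HasSatakeParamAt v α ∧ σ.IsUnramifiedAt v ∧ σ.HasFrobCharpolyAt v (Literature.NumberTheory.Automorphic.satakePolynomial α)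

/-- item stmt-Langlands-14193 · crux · rank 2 · open · by planner
why it might fail: Not implied by reciprocity: σ's π is non-cohomological, so depth-7^s occurrence is Hansen Conj 1.2.3 / big R=𝕋_𝔪 for GL₃/ℚ (l₀=1), conditional even on GeeNewton2020's hypotheses; im σ̄=PSL₂(7)↷L(2) is not adequate at 7 (H¹(SL₂(7),L(4))≠0, AJL); even s=1 (non-self-dual 𝔽₇[ε]-tangent) is unexhibited.
sources: CalegariGeraghty2017, GeeNewton2020, HansenUniversalEigenvarieties2017, Scholze2015, Thorne2012, AndersenJorgensenLandrock1983
[crux] (card crux α, in torsion form) Let σ be of odd Klein type and ι : ℚ̄₇ ≃ ℂ. If the mod-𝔪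
eigensystem of ι⁻¹σ occurs in some H^i(Γ₁(N) ⊂ SL₃(ℤ), 𝔽̄₇), N > 0 (an 𝔽̄₇-eigenvector of all
T(ℓ,k), ℓ ∤ N prime, k ≤ 3, and of the diamond operators, whose Hecke–Frobenius polynomial X³ −
a(ℓ,1)X² + ℓ a(ℓ,2)X − ℓ³ ε(ℓ) is ≡ charpoly ι⁻¹σ(Frob_ℓ) mod 𝔪 at every ℓ ∤ N, and σ unramified at
every such ℓ), then for EVERY s ≥ 1 there are N_s > 0, i_s and lifts a, ε to 𝒪 = 𝒪_{ℚ̄₇} such that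
T(ℓ,k) ↦ a(ℓ,k), ⟨d⟩ ↦ ε(d) mod 7^s kills every (non-commutative) polynomial relation among these
operators on H^{i_s}(Γ₁(N_s), 𝒪/7^s) — i.e. extends to an algebra homomorphism from the Hecke
algebra they generate to 𝒪/7^s — with the same Frobenius congruences mod 7^s. Informal content: σ is
a point of Spf 𝕋(K^p)_𝔪 for the completed cohomology of GL₃/ℚ at 𝔪 = 𝔪(Ad⁰ρ̄_g): the conclusion of
big R_σ̄ = 𝕋_𝔪 (defect l₀ = 1) applied to the 𝒪-point σ of R_σ̄, read at finite level. Already s = 1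
(mod 7 = 𝔭²) asks for a NON-self-dual 𝔽₇[ε]-eigensystem: the tangent direction of σ at 𝔪.
[difficulty: open-problem] -/
@[route_item "route-Langlands-KleinTorsionDoor", crux]
def SeptadicTorsionOccurrence : Prop :=
  ∀ [Fact (Nat.Prime 7)] (ι : PadicAlgCl 7 ≃+* ℂ) (σ : Literature.NumberTheory.GaloisRepresentations.FramedGaloisRep ℚ ℂ 3), Nonempty (↥σ.toMonoidHom.range ≃* GL (Fin 3) (ZMod 2)) → (∀ (φ : ℚ →+* ℝ) (c : Field.absoluteGaloisGroup ℚ), Literature.NumberTheory.GaloisRepresentations.IsComplexConjugation φ c → σ c ≠ 1) → (∃ (N i : ℕ) (a : ℕ → ℕ → ↥(Valued.v (R := PadicAlgCl 7)).valuationSubring) (ε : (ZMod N)ˣ → ↥(Valued.v (R := PadicAlgCl 7)).valuationSubring), 0 < N ∧ Literature.NumberTheory.Automorphic.TorsionHeckeEigensystem.Occurs 3 N (IsLocalRing.ResidueField ↥(Valued.v (R := PadicAlgCl 7)).valuationSubring) i ∅ (fun ℓ k => IsLocalRing.residue ↥(Valued.v (R := PadicAlgCl 7)).valuationSubring (a ℓ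 k)) (fun d => IsLocalRing.residue ↥(Valued.v (R := PadicAlgCl 7)).valuationSubring (ε d)) ∧ ∀ (v : IsDedekindDomain.HeightOneSpectrum (NumberField.RingOfIntegers ℚ)) (hv : Nat.Coprime v.residueCard N), σ.IsUnramifiedAt v ∧ ∀ P : Polynomial ℂ, σ.HasFrobCharpolyAt v P → ‖(P.map (ι.symm : ℂ →+* PadicAlgCl 7)).coeff 2 + (a v.residueCard 1 : PadicAlgCl 7)‖ < 1 ∧ ‖(P.map (ι.symm : ℂ →+* PadicAlgCl 7)).coeff 1 - (v.residueCard : PadicAlgCl 7) * (a v.residueCard 2 : PadicAlgCl 7)‖ < 1 ∧ ‖(P.map (ι.symm : ℂ →+* PadicAlgCl 7)).coeff 0 + (v.residueCard : PadicAlgCl 7) ^ 3 * (ε (ZMod.unitOfCoprime v.residueCard hv) : PadicAlgCl 7)‖ < 1) → ∀ s : ℕ, 1 ≤ s → ∃ (N i : ℕ) (a : ℕ → ℕ → ↥(Valued.v (R := PadicAlgCl 7)).valuationSubring) (ε : (ZMod N)ˣ → ↥(Valued.v (R := PadicAlgCl 7)).valuationSubring), 0 < N ∧ (∀ F : FreeAlgebra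 (↥(Valued.v (R := PadicAlgCl 7)).valuationSubring ⧸ Ideal.span {((7 : ↥(Valued.v (R := PadicAlgCl 7)).valuationSubring) ^ s)}) ({lk : ℕ × ℕ // Nat.Prime lk.1 ∧ ¬ lk.1 ∣ N ∧ lk.2 ≤ 3} ⊕ (ZMod N)ˣ), FreeAlgebra.lift (↥(Valued.v (R := PadicAlgCl 7)).valuationSubring ⧸ Ideal.span {((7 : ↥(Valued.v (R := PadicAlgCl 7)).valuationSubring) ^ s)}) (Sum.elim (fun lk : {lk : ℕ × ℕ // Nat.Prime lk.1 ∧ ¬ lk.1 ∣ N ∧ lk.2 ≤ 3} => Literature.NumberTheory.Automorphic.SLn.heckeT 3 (Literature.NumberTheory.Automorphic.SLn.Gamma1 3 N) (↥(Valued.v (R := PadicAlgCl 7)).valuationSubring ⧸ Ideal.span {((7 : ↥(Valued.v (R := PadicAlgCl 7)).valuationSubring) ^ s)}) i lk.1.1 lk.1.2) (fun d : (ZMod N)ˣ => Literature.NumberTheory.Automorphic.SLn.diamondOp 3 N (↥(Valued.v (R := PadicAlgCl 7)).valuationSubring ⧸ Ideal.span {((7 : ↥(Valued.v (R := PadicAlgCl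 7)).valuationSubring) ^ s)}) i (d : ZMod N))) F = 0 → FreeAlgebra.lift (↥(Valued.v (R := PadicAlgCl 7)).valuationSubring ⧸ Ideal.span {((7 : ↥(Valued.v (R := PadicAlgCl 7)).valuationSubring) ^ s)}) (Sum.elim (fun lk : {lk : ℕ × ℕ // Nat.Prime lk.1 ∧ ¬ lk.1 ∣ N ∧ lk.2 ≤ 3} => Ideal.Quotient.mk (Ideal.span {((7 : ↥(Valued.v (R := PadicAlgCl 7)).valuationSubring) ^ s)}) (a lk.1.1 lk.1.2)) (fun d : (ZMod N)ˣ => Ideal.Quotient.mk (Ideal.span {((7 : ↥(Valued.v (R := PadicAlgCl 7)).valuationSubring) ^ s)}) (ε d))) F = 0) ∧ ∀ (v : IsDedekindDomain.HeightOneSpectrum (NumberField.RingOfIntegers ℚ)) (hv : Nat.Coprime v.residueCard N), σ.IsUnramifiedAt v ∧ ∀ P : Polynomial ℂ, σ.HasFrobCharpolyAt v P → ‖(P.map (ι.symm : ℂ →+* PadicAlgCl 7)).coeff 2 + (a v.residueCard 1 : PadicAlgCl 7)‖ ≤ (1 / 7 : ℝ) ^ s ∧ ‖(P.map (ι.symm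 : ℂ →+* PadicAlgCl 7)).coeff 1 - (v.residueCard : PadicAlgCl 7) * (a v.residueCard 2 : PadicAlgCl 7)‖ ≤ (1 / 7 : ℝ) ^ s ∧ ‖(P.map (ι.symm : ℂ →+* PadicAlgCl 7)).coeff 0 + (v.residueCard : PadicAlgCl 7) ^ 3 * (ε (ZMod.unitOfCoprime v.residueCard hv) : PadicAlgCl 7)‖ ≤ (1 / 7 : ℝ) ^ s

/-- item stmt-Langlands-14194 · crux · rank 3 · open · by planner
why it might fail: Weight −ρ (inf. char. 0) is non-cohomological and GL₃/ℚ has no Shimura variety: σ's π is in Calegari's 'fourth class', no receptacle; APS Conj 0.1 makes non-self-dual points 7-adically rigid: no classical family reaches x_σ, no overconvergent→classical argument. False only with FM–Langlands (B) n=3.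
sources: FontaineMazurGeometric1995, Calegari2023, AshPollackStevens2007, CalegariMazur2008, HansenUniversalEigenvarieties2017, BuzzardGeeLMS2014
[crux] (card crux β: archimedean realisation at weight (0,0,0) = −ρ, torsion form) Let σ : Γ_ℚ →
GL₃(ℂ) be irreducible with finite image and of odd type (σ(c) ≠ 1), ι : ℚ̄₇ ≃ ℂ. If for every s ≥ 1
the eigensystem of ι⁻¹σ mod 7^s is a point of the Hecke algebra of some H^i(Γ₁(N) ⊂ SL₃(ℤ), 𝒪/7^s),
N > 0 (exactly the conclusion of SeptadicTorsionOccurrence), then σ is automorphic: ∃ L-algebraic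
cuspidal π on GL₃(𝔸_ℚ) with Satake parameter = Frobenius eigenvalues of σ at almost all v. A special
case of Fontaine–Mazur–Langlands for n = 3 over ℚ with the extra hypothesis '7-adically
pro-automorphic in torsion'; the expected π_∞ is the tempered principal series of signs (1, sgn,
sgn) at infinitesimal character 0. Stated for all odd finite-image σ (shared by the Valentiner 3.A₆
and every other rank-3 Artin member), used by `closes` only for Klein σ. [deps:
SeptadicTorsionOccurrence] [difficulty: open-problem] -/
@[route_item "route-Langlands-KleinTorsionDoor", crux]
def ArtinTorsionClassicalityGL3 : Prop :=
  ∀ [Fact (Nat.Prime 7)] (ι : PadicAlgCl 7 ≃+* ℂ) (σ : Literature.NumberTheory.GaloisRepresentations.FramedGaloisRep ℚ ℂ 3), σ.toGaloisRep.IsIrreducible → Finite ↥σ.toMonoidHom.range → (∀ (φ : ℚ →+* ℝ) (c : Field.absoluteGaloisGroup ℚ), Literature.NumberTheory.GaloisRepresentations.IsComplexConjugation φ c → σ c ≠ 1) → (∀ s : ℕ, 1 ≤ s → ∃ (N i : ℕ) (a : ℕ → ℕ → ↥(Valued.v (R := PadicAlgCl 7)).valuationSubring) (ε : (ZMod N)ˣ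 → ↥(Valued.v (R := PadicAlgCl 7)).valuationSubring), 0 < N ∧ (∀ F : FreeAlgebra (↥(Valued.v (R := PadicAlgCl 7)).valuationSubring ⧸ Ideal.span {((7 : ↥(Valued.v (R := PadicAlgCl 7)).valuationSubring) ^ s)}) ({lk : ℕ × ℕ // Nat.Prime lk.1 ∧ ¬ lk.1 ∣ N ∧ lk.2 ≤ 3} ⊕ (ZMod N)ˣ), FreeAlgebra.lift (↥(Valued.v (R := PadicAlgCl 7)).valuationSubring ⧸ Ideal.span {((7 : ↥(Valued.v (R := PadicAlgCl 7)).valuationSubring) ^ s)}) (Sum.elim (fun lk : {lk : ℕ × ℕ // Nat.Prime lk.1 ∧ ¬ lk.1 ∣ N ∧ lk.2 ≤ 3} => Literature.NumberTheory.Automorphic.SLn.heckeT 3 (Literature.NumberTheory.Automorphic.SLn.Gamma1 3 N) (↥(Valued.v (R := PadicAlgCl 7)).valuationSubring ⧸ Ideal.span {((7 : ↥(Valued.v (R := PadicAlgCl 7)).valuationSubring) ^ s)}) i lk.1.1 lk.1.2) (fun d : (ZMod N)ˣ => Literature.NumberTheory.Automorphic.SLn.diamondOp 3 N (↥(Valued.v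 (R := PadicAlgCl 7)).valuationSubring ⧸ Ideal.span {((7 : ↥(Valued.v (R := PadicAlgCl 7)).valuationSubring) ^ s)}) i (d : ZMod N))) F = 0 → FreeAlgebra.lift (↥(Valued.v (R := PadicAlgCl 7)).valuationSubring ⧸ Ideal.span {((7 : ↥(Valued.v (R := PadicAlgCl 7)).valuationSubring) ^ s)}) (Sum.elim (fun lk : {lk : ℕ × ℕ // Nat.Prime lk.1 ∧ ¬ lk.1 ∣ N ∧ lk.2 ≤ 3} => Ideal.Quotient.mk (Ideal.span {((7 : ↥(Valued.v (R := PadicAlgCl 7)).valuationSubring) ^ s)}) (a lk.1.1 lk.1.2)) (fun d : (ZMod N)ˣ => Ideal.Quotient.mk (Ideal.span {((7 : ↥(Valued.v (R := PadicAlgCl 7)).valuationSubring) ^ s)}) (ε d))) F = 0) ∧ ∀ (v : IsDedekindDomain.HeightOneSpectrum (NumberField.RingOfIntegers ℚ)) (hv : Nat.Coprime v.residueCard N), σ.IsUnramifiedAt v ∧ ∀ P : Polynomial ℂ, σ.HasFrobCharpolyAt v P → ‖(P.map (ι.symm : ℂ →+* PadicAlgCl 7)).coeff 2 + (a v.residueCard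 1 : PadicAlgCl 7)‖ ≤ (1 / 7 : ℝ) ^ s ∧ ‖(P.map (ι.symm : ℂ →+* PadicAlgCl 7)).coeff 1 - (v.residueCard : PadicAlgCl 7) * (a v.residueCard 2 : PadicAlgCl 7)‖ ≤ (1 / 7 : ℝ) ^ s ∧ ‖(P.map (ι.symm : ℂ →+* PadicAlgCl 7)).coeff 0 + (v.residueCard : PadicAlgCl 7) ^ 3 * (ε (ZMod.unitOfCoprime v.residueCard hv) : PadicAlgCl 7)‖ ≤ (1 / 7 : ℝ) ^ s) → ∃ (hcpt : Literature.NumberTheory.Automorphic.isCompact_glFiniteIntegralLevel 3 ℚ) (π : Literature.NumberTheory.Automorphic.CuspidalAutomorphicRepData 3 ℚ hcpt), π.1.IsLAlgebraic ∧ ∀ᶠ v : IsDedekindDomain.HeightOneSpectrum (NumberField.RingOfIntegers ℚ) in Filter.cofinite, ∃ α : Multiset ℂ, π.1.HasSatakeParamAt v α ∧ σ.IsUnramifiedAt v ∧ σ.HasFrobCharpolyAt v (Literature.NumberTheory.Automorphic.satakePolynomial α)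

/-- item stmt-Langlands-14195 · support · rank 9 · open · by planner
why it might fail: Bookkeeping risks only: Hecke–Frobenius normalisation (arithmetic Frob; X³−a₁X²+ℓa₂X−ℓ³ε(ℓ), T(ℓ,3)=id), the ω-twist reaching det=1 at 7|N, Ash–Stevens reduction to trivial weight, eigenvector-sense occurrence over 𝔽̄₇; KW(7), Tate lift, Brauer table, GJ: in print, not in Lean.
sources: KhareWintenberger2009, SerreDurham1977, Humphreys2005, GelbartJacquet1978, doi:10.1515/crll.1986.365.192, AshGunnellsMcconnell2011
[support] (card item γ, the residual engine; theorem-sized modulo theorems in print) for every ι :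
ℚ̄₇ ≃ ℂ and every σ : Γ_ℚ → GL₃(ℂ) with image ≅ GL₃(𝔽₂) and σ(c) ≠ 1, the mod-𝔪 eigensystem of ι⁻¹σ
OCCURS (Ash's eigenvector sense, tree `TorsionHeckeEigensystem.Occurs` over the residue field 𝔽̄₇ of
𝒪_{ℚ̄₇}) in some H^i(Γ₁(N) ⊂ SL₃(ℤ), 𝔽̄₇), N > 0, with Hecke–Frobenius polynomial X³ − a(ℓ,1)X² + ℓ
a(ℓ,2)X − ℓ³ ε(ℓ) ≡ charpoly ι⁻¹σ(Frob_ℓ) mod 𝔪 at every ℓ ∤ N (and σ unramified at every such ℓ).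
Proof plan: θ : im σ ≅ GL₃(𝔽₂) ≅ PSL₂(𝔽₇) ⊂ PGL₂(𝔽̄₇); Tate-lift θ∘σ to σ̃ : Γ_ℚ → GL₂(𝔽̄₇)
unramified where σ is (SerreDurham1977 §6); σ̃(c) is a non-scalar involution ⇒ det σ̃(c) = −1, σ̃
irreducible (projective image PSL₂(7)) ⇒ σ̃ ≅ ρ̄_g, g newform of weight k ≥ 2, level N(σ̃)
(KhareWintenberger2009); 7-modular Brauer table of PSL₂(7): the degree-3 characters (3,−1,0,1 on
1A,2A,3A,4A) are the Brauer character of L(2) = Ad⁰ of the natural SL₂(𝔽₇)-module (Humphreys2005;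
GAP-certifiable) ⇒ (ι⁻¹σ)‾ ≅ Ad⁰(ρ̄_g) (Brauer–Nesbitt; L(2) irreducible so no semisimplification
issue); Ad(π_g) is cuspidal (g non-CM) regular algebraic on GL₃(𝔸_ℚ) with Galois representation
Ad⁰ρ_g of Hodge–Tate weights {1 -/
@[route_item "route-Langlands-KleinTorsionDoor", crux]
def ResidualSymSquareTorsionDoor : Prop :=
  ∀ [Fact (Nat.Prime 7)] (ι : PadicAlgCl 7 ≃+* ℂ) (σ : Literature.NumberTheory.GaloisRepresentations.FramedGaloisRep ℚ ℂ 3), Nonempty (↥σ.toMonoidHom.range ≃* GL (Fin 3) (ZMod 2)) → (∀ (φ : ℚ →+* ℝ) (c : Field.absoluteGaloisGroup ℚ), Literature.NumberTheory.GaloisRepresentations.IsComplexConjugation φ c → σ c ≠ 1) → ∃ (N i : ℕ) (a : ℕ → ℕ → ↥(Valued.v (R := PadicAlgCl 7)).valuationSubring) (ε : (ZMod N)ˣ → ↥(Valued.v (R := PadicAlgCl 7)).valuationSubring), 0 < N ∧ Literature.NumberTheory.Automorphic.TorsionHeckeEigensystem.Occurs 3 N (IsLocalRing.ResidueField ↥(Valued.v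 (R := PadicAlgCl 7)).valuationSubring) i ∅ (fun ℓ k => IsLocalRing.residue ↥(Valued.v (R := PadicAlgCl 7)).valuationSubring (a ℓ k)) (fun d => IsLocalRing.residue ↥(Valued.v (R := PadicAlgCl 7)).valuationSubring (ε d)) ∧ ∀ (v : IsDedekindDomain.HeightOneSpectrum (NumberField.RingOfIntegers ℚ)) (hv : Nat.Coprime v.residueCard N), σ.IsUnramifiedAt v ∧ ∀ P : Polynomial ℂ, σ.HasFrobCharpolyAt v P → ‖(P.map (ι.symm : ℂ →+* PadicAlgCl 7)).coeff 2 + (a v.residueCard 1 : PadicAlgCl 7)‖ < 1 ∧ ‖(P.map (ι.symm : ℂ →+* PadicAlgCl 7)).coeff 1 - (v.residueCard : PadicAlgCl 7) * (a v.residueCard 2 : PadicAlgCl 7)‖ < 1 ∧ ‖(P.map (ι.symm : ℂ →+* PadicAlgCl 7)).coeff 0 + (v.residueCard : PadicAlgCl 7) ^ 3 * (ε (ZMod.unitOfCoprime v.residueCard hv) : PadicAlgCl 7)‖ < 1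

/-- item stmt-Langlands-14196 · support · rank 9 · open · by planner
sources: BuzzardGeeLMS2014, FontaineMazurGeometric1995, Calegari2023
[support] X → Langlands: the rest of the summit (all other n, F, weights and images; direction (A);
the Valentiner/A₅ and totally-real Klein members; the upgrade of the a.e. Satake–Frobenius matching
to `Corresponds` at every finite place by local–global compatibility + strong multiplicity one,
incl. the π ↦ π^∨ bookkeeping between `satakePolynomial` and `arithFrobPolyOfSatake ι q 1`). Not
this route's business; filed so that `closes` ends in the summit constant; shared junction for every
rank-3 Artin card over ℚ. [difficulty: open-problem] -/
@[route_item "route-Langlands-KleinTorsionDoor", crux]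
def KleinArtinJunction : Prop :=
  KleinStrongArtin → _root_.Langlands

/-- item stmt-Langlands-14412 · support · rank 9 · open · by planner
sources: BuzzardGeeLMS2014, KhareWintenberger2009
[support] target glue (badge repair route.target-unreachable): the residual door (mod-𝔪 occurrence
of ι⁻¹σ in H^•(Γ₁(N) ⊂ SL₃(ℤ), 𝔽̄₇) for odd Klein-image σ), 7-adic torsion occurrence at every depth
7^s (α) and Artin-weight torsion classicality on GL₃/ℚ (β) together give the target KleinStrongArtin
(strong Artin, Tunnell a.e. sense, for every irreducible odd σ : Γ_ℚ → GL₃(ℂ) with image ≅ GL₃(𝔽₂)).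
Pure logic, provable now: `Fact (Nat.Prime 7)` by norm_num; an abstract ι : ℚ̄₇ ≃+* ℂ from
`IsAlgClosed.ringEquiv_of_equiv_of_charZero` (both of cardinality 𝔠, char 0); `Finite ↥σ.range` from
the isomorphism with the finite group GL₃(𝔽₂) (`Finite.of_equiv`); then β ι σ hirr hfin hodd (α ι σ
hK hodd (Door ι σ hK hodd)) — literally the body of the deciding theorem `closes` minus the junction
(planner Sketch.lean proves it as an `example`, lean check rc 0). With it `closes` factors as
KleinArtinJunction ∘ this glue. [deps: ResidualSymSquareTorsionDoor, SeptadicTorsionOccurrence,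
ArtinTorsionClassicalityGL3, KleinStrongArtin] [difficulty: provable-now] -/
@[route_item "route-Langlands-KleinTorsionDoor"]
def TorsionChainToKleinStrongArtin : Prop :=
  ResidualSymSquareTorsionDoor → SeptadicTorsionOccurrence → ArtinTorsionClassicalityGL3 → KleinStrongArtin

/-- item stmt-Langlands-14197 · assembly · rank 1 · open · by planner
sources: BuzzardGeeLMS2014, KhareWintenberger2009
[assembly] ResidualSymSquareTorsionDoor → SeptadicTorsionOccurrence → ArtinTorsionClassicalityGL3 →
KleinArtinJunction → Langlands. -/
@[route_item "route-Langlands-KleinTorsionDoor"]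
def Assembly : Prop :=
  ResidualSymSquareTorsionDoor → SeptadicTorsionOccurrence → ArtinTorsionClassicalityGL3 → KleinArtinJunction → _root_.Langlands

/-! D-0027 §2.1 — DECIDING THEOREM (planner-authored via `route open/edit --closes-file`; by planner-plancard-Langlands-Langlands-psl2q-ar-094b763e-g2-0 2026-08-15T19:06:28Z):
its hypotheses are this route's items and its conclusion the sub-problem Statement (glue_lint), and it elaborates with this file. -/

@[closes "route-Langlands-KleinTorsionDoor"] theorem closes (hD : ResidualSymSquareTorsionDoor) (hα : SeptadicTorsionOccurrence)
    (hβ : ArtinTorsionClassicalityGL3) (hJ : KleinArtinJunction) : _root_.Langlands := by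
  haveI hp : Fact (Nat.Prime 7) := ⟨by norm_num⟩
  -- an abstract field isomorphism ι : ℚ̄₇ ≃+* ℂ (both algebraically closed, char 0, cardinality 𝔠)
  obtain ⟨ι⟩ : Nonempty (PadicAlgCl 7 ≃+* ℂ) := by
    have hQ : Cardinal.mk ℚ_[7] = Cardinal.continuum := by
      apply le_antisymm
      · have hsurj : Function.Surjective (Padic.mk : PadicSeq 7 → ℚ_[7]) :=
          fun x ↦ Quotient.inductionOn' x fun a ↦ ⟨a, rfl⟩
        calc Cardinal.mk ℚ_[7] ≤ Cardinal.mk (PadicSeq 7) := Cardinal.mk_le_of_surjective hsurj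
          _ ≤ Cardinal.mk (ℕ → ℚ) := Cardinal.mk_subtype_le _
          _ = Cardinal.continuum := by
            rw [Cardinal.mk_arrow, Cardinal.mk_eq_aleph0 ℚ, Cardinal.mk_eq_aleph0 ℕ]
            simp [Cardinal.aleph0_power_aleph0]
      · exact continuum_le_cardinal_of_nontriviallyNormedField ℚ_[7]
    have hC : Cardinal.mk (PadicAlgCl 7) = Cardinal.continuum := by
      apply le_antisymm
      · refine (Algebra.IsAlgebraic.cardinalMk_le_max ℚ_[7] (PadicAlgCl 7)).trans ?_
        rw [hQ, max_eq_left Cardinal.aleph0_le_continuum]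
      · rw [← hQ]
        exact Cardinal.mk_le_of_injective (algebraMap ℚ_[7] (PadicAlgCl 7)).injective
    refine IsAlgClosed.ringEquiv_of_equiv_of_charZero ?_ (Cardinal.eq.1 ?_)
    · rw [hC]; exact Cardinal.aleph0_lt_continuum
    · rw [hC, Cardinal.mk_complex]
  -- the junction reduces the summit to strong Artin for odd-type Klein-image σ (the target `KleinStrongArtin`)
  refine hJ ?_
  intro σ hirr hK hodd
  -- the image is the finite simple group GL₃(𝔽₂) ≅ PSL₂(𝔽₇)
  have hfin : Finite ↥σ.toMonoidHom.range := by
    obtain ⟨e⟩ := hK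
    haveI : Finite (GL (Fin 3) (ZMod 2)) := Finite.of_injective _ Units.val_injective
    exact Finite.of_equiv _ e.symm.toEquiv
  -- door (residual occurrence mod 𝔪) ⟹ occurrence at every 7-adic depth ⟹ automorphy
  exact hβ ι σ hirr hfin hodd (hα ι σ hK hodd (hD ι σ hK hodd))

end Summit.Langlands.Langlands.Theses.KleinTorsionDoor
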